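import Literature.Probability.Percolation.AdjExitChains
import Literature.Probability.Percolation.ArmSeparationTubes
import HarnessLib

/-!
# The catch tubes of a fenced exit

Topic `Literature/Probability/Percolation`; family `crit-perc` / near-critical percolation on `𝕋`.
A brick of the near-critical arm-separation theorem for four arms in the ADJACENT colour
arrangement (P. Nolin, EJP 13 (2008), Thm. 11, `j = 4`, `σ = BBWW` [arXiv 0711.4948: Thm. 10]),
landing step for two arms of one colour. The two corridor systems of a fenced exit (tip
`z = (2M, t)`, scale `k ≥ 2`, in the frame of its side) start with the **catch tubes**

* `catchTubeA M t k` — the vertical tube `[2M + 1, 2M + k - 1] × [t + 1, t + 2k + 1]` (`TOPLEFT`):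
  any crossing of it meets the connection of the fence (`TermFence.catchA_meets`, from
  `TermFence.exists_topleft_crossing`);
* `catchTubeB M t k` — the horizontal tube `[2M + k, 2M + 3k] × [t + 1, t + k - 1]`: any crossing of
  it meets the lower branch `B` of the tall crossing (`TermFenceT.catchB_meets`, from
  `TermFenceT.exists_midlow_chain`);

and the mirrored tubes below the tip for fences of terms explored from above
(`catchTubeA'`, `catchTubeB'`, `TermFenceUp.catchA'_meets`, `TermFenceUpT.catchB'_meets`). The two
catch tubes of one exit are disjoint (`disjoint_catchTubeA_catchTubeB`). Everything here is proved.

## References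

* P. Nolin, Near-critical percolation in two dimensions, *Electron. J. Probab.* 13 (2008), §4.3
  Prop. 12 (proof) (arXiv 0711.4948: Prop. 11) [Nolin2008].
* H. Kesten, *Percolation theory for mathematicians* (1982), §2.2 [KestenPTM1982].
-/

noncomputable section

open Set

namespace Literature.Probability.Percolation

open LatticeModels

/-- **Catch tube `A`** (above the tip): vertical, `[2M + 1, 2M + k - 1] × [t + 1, t + 2k + 1]`. [cite: Nolin2008, §4.3 Prop. 12 (proof) (arXiv 0711.4948: Prop. 11)] -/
def catchTubeA (M : ℕ) (t : ℤ) (k : ℕ) : Tube := ⟨2 * (M : ℤ) + 1, t + 1, k - 2, 2 * k, false⟩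

/-- **Catch tube `B`** (above the tip): horizontal, `[2M + k, 2M + 3k] × [t + 1, t + k - 1]`. [cite: Nolin2008, §4.3 Prop. 12 (proof) (arXiv 0711.4948: Prop. 11)] -/
def catchTubeB (M : ℕ) (t : ℤ) (k : ℕ) : Tube := ⟨2 * (M : ℤ) + k, t + 1, 2 * k, k - 2, true⟩

/-- **Catch tube `A'`** (below the tip): vertical, `[2M + 1, 2M + k - 1] × [t - 2k - 1, t - 1]`. [cite: Nolin2008, §4.3 Prop. 12 (proof) (arXiv 0711.4948: Prop. 11)] -/
def catchTubeA' (M : ℕ) (t : ℤ) (k : ℕ) : Tube := ⟨2 * (M : ℤ) + 1, t - 2 * k - 1, k - 2, 2 * k, false⟩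

/-- **Catch tube `B'`** (below the tip): horizontal, `[2M + k, 2M + 3k] × [t - k + 1, t - 1]`. [cite: Nolin2008, §4.3 Prop. 12 (proof) (arXiv 0711.4948: Prop. 11)] -/
def catchTubeB' (M : ℕ) (t : ℤ) (k : ℕ) : Tube := ⟨2 * (M : ℤ) + k, t - k + 1, 2 * k, k - 2, true⟩

/-- The two catch tubes above the tip are disjoint (columns `< 2M + k` against `≥ 2M + k`). [folklore] -/
theorem disjoint_catchTubeA_catchTubeB (M : ℕ) (t : ℤ) (k : ℕ) (hk : 2 ≤ k) :
    Disjoint (catchTubeA M t k).box (catchTubeB M t k).box := by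
  rw [Set.disjoint_left]
  intro v hv hv'
  rw [Tube.mem_box] at hv hv'
  simp only [catchTubeA, catchTubeB] at hv hv'
  omega

/-- The two catch tubes below the tip are disjoint. [folklore] -/
theorem disjoint_catchTubeA'_catchTubeB' (M : ℕ) (t : ℤ) (k : ℕ) (hk : 2 ≤ k) :
    Disjoint (catchTubeA' M t k).box (catchTubeB' M t k).box := by
  rw [Set.disjoint_left]
  intro v hv hv'
  rw [Tube.mem_box] at hv hv'
  simp only [catchTubeA', catchTubeB'] at hv hv'
  omega

namespace TermFence

variable {M k : ℕ} {c : Finset (Site 2)} {z : Site 2} {ω : SiteConfig (Site 2)} {S : Set (Site 2)}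
  (T : TermFence M c z k ω S)

/-- **A crossing of the catch tube `A` meets the connection of the fence** (`k ≥ 2`, tip on
`trapO M`, attachment of norm `≤ 2M`): a vertical crossing (sites `X` inside the tube) of
`catchTubeA M (z 1) k` and the horizontal crossing of `TOPLEFT` by `F` meet. [cite: KestenPTM1982, §2.2] -/
theorem catchA_meets (hk : 2 ≤ k) (hz : z ∈ trapO M) (hq : triNorm T.q ≤ 2 * M) {X : Set (Site 2)} {x y : Site 2}
    (hX : X ⊆ (catchTubeA M (z 1) k).box) (hP : PathIn triGraph X x y) (hx : x 1 = z 1 + 1) (hy : y 1 = z 1 + 2 * k + 1) :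
    ∃ v, v ∈ X ∧ v ∈ T.F := by
  have hz' := trapO_coord hz
  obtain ⟨⟨a, b, ha, hb, hQ⟩, hrows⟩ := T.exists_topleft_crossing hk hz hq
  have hk2 : ((k - 2 : ℕ) : ℤ) = (k : ℤ) - 2 := by omega
  obtain ⟨v, hvX, hvF⟩ := PathIn.tri_crossings_meet' (L := z 0 + 1) (R := z 0 + ((k - 1 : ℕ) : ℤ)) (B := z 1 + 1)
    (T := z 1 + 2 * k + 1) (A := X) (A' := T.F ∩ {v | z 0 + 1 ≤ v 0 ∧ v 0 ≤ z 0 + ((k - 1 : ℕ) : ℤ)})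
    (fun w hw => by have h := hX hw; rw [Tube.mem_box] at h; simp only [catchTubeA] at h; omega)
    (fun w hw => by have h := hrows w hw.1 hw.2.1; have h2 := hw.2; simp only [Set.mem_setOf_eq] at h2; omega)
    hP hx hy hQ ha hb
  exact ⟨v, hvX, hvF.1⟩

end TermFence

namespace TermFenceT

variable {M k : ℕ} {c : Finset (Site 2)} {z : Site 2} {ω : SiteConfig (Site 2)} {S : Set (Site 2)}
  (T : TermFenceT M c z k ω S)

/-- **A crossing of the catch tube `B` meets the lower branch** (`k ≥ 2`): for the set `B` of
`exists_midlow_chain` and a horizontal crossing (sites `X` inside the tube) of `catchTubeB M (z 1) k`,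
`X ∩ B ≠ ∅`. Packaged: the branch set and the meeting. [cite: KestenPTM1982, §2.2] -/
theorem catchB_meets (hk : 2 ≤ k) (hz : z ∈ trapO M) {X : Set (Site 2)} {x y : Site 2}
    (hX : X ⊆ (catchTubeB M (z 1) k).box) (hP : PathIn triGraph X x y) (hx : x 0 = 2 * (M : ℤ) + k)
    (hy : y 0 = 2 * (M : ℤ) + 3 * k) :
    ∃ Bs : Set (Site 2), Bs ⊆ triStrip (z 0 + k) (z 1 + 1) k (2 * k - 1) ∩ ω ∧ T.m ∈ Bs ∧ (∀ w ∈ Bs, PathIn triGraph Bs T.m w) ∧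
      ∃ v, v ∈ X ∧ v ∈ Bs := by
  have hz' := trapO_coord hz
  obtain ⟨Bs, hBs, hmB, hstar, a, b, ha, hb, hQ⟩ := T.exists_midlow_chain hk
  have hk2 : ((k - 2 : ℕ) : ℤ) = (k : ℤ) - 2 := by omega
  have hk1 : ((k - 1 : ℕ) : ℤ) = (k : ℤ) - 1 := by omega
  have hk21 : ((2 * k - 1 : ℕ) : ℤ) = 2 * (k : ℤ) - 1 := by omega
  -- the part of the horizontal crossing inside the columns `[2M + k, 2M + 2k]`
  obtain ⟨x', y', hx', hy', hP'⟩ := hP.exists_slab_crossing 0 (L := 2 * (M : ℤ) + k) (R := 2 * (M : ℤ) + 2 * k)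
    (by omega) (by rw [hx]) (by rw [hy]; omega)
  obtain ⟨v, hvB, hvX⟩ := PathIn.tri_crossings_meet' (L := 2 * (M : ℤ) + k) (R := 2 * (M : ℤ) + 2 * k)
    (B := z 1 + 1) (T := z 1 + ((k - 1 : ℕ) : ℤ))
    (A := Bs ∩ {v | z 1 + 1 ≤ v 1 ∧ v 1 ≤ z 1 + ((k - 1 : ℕ) : ℤ)})
    (A' := X ∩ {v | 2 * (M : ℤ) + k ≤ v 0 ∧ v 0 ≤ 2 * (M : ℤ) + 2 * k})
    (fun w hw => by
      have h := (hBs hw.1).1; rw [mem_triStrip, hk21] at h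
      have h2 := hw.2; simp only [Set.mem_setOf_eq] at h2; omega)
    (fun w hw => by
      have h := hX hw.1; rw [Tube.mem_box] at h; simp only [catchTubeB] at h
      have h2 := hw.2; simp only [Set.mem_setOf_eq] at h2; omega)
    hQ.symm hb ha hP' hx' hy'
  exact ⟨Bs, hBs, hmB, hstar, v, hvX.1, hvB.1⟩

end TermFenceT

namespace TermFenceUp

variable {M k : ℕ} {d : Finset (Site 2)} {z : Site 2} {ω : SiteConfig (Site 2)} {S : Set (Site 2)}
  (T : TermFenceUp M d z k ω S)

/-- **A crossing of the catch tube `A'` meets the connection of a fence from above.** [cite: KestenPTM1982, §2.2] -/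
theorem catchA'_meets (hk : 2 ≤ k) (hz : z ∈ trapO M) (hq : triNorm T.q ≤ 2 * M) {X : Set (Site 2)} {x y : Site 2}
    (hX : X ⊆ (catchTubeA' M (z 1) k).box) (hP : PathIn triGraph X x y) (hx : x 1 = z 1 - 2 * k - 1) (hy : y 1 = z 1 - 1) :
    ∃ v, v ∈ X ∧ v ∈ T.F := by
  have hz' := trapO_coord hz
  obtain ⟨⟨a, b, ha, hb, hQ⟩, hrows⟩ := T.exists_botleft_crossing hk hz hq
  obtain ⟨v, hvX, hvF⟩ := PathIn.tri_crossings_meet' (L := z 0 + 1) (R := z 0 + ((k - 1 : ℕ) : ℤ)) (B := z 1 - 2 * k - 1)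
    (T := z 1 - 1) (A := X) (A' := T.F ∩ {v | z 0 + 1 ≤ v 0 ∧ v 0 ≤ z 0 + ((k - 1 : ℕ) : ℤ)})
    (fun w hw => by have h := hX hw; rw [Tube.mem_box] at h; simp only [catchTubeA'] at h; omega)
    (fun w hw => by have h := hrows w hw.1 hw.2.1; have h2 := hw.2; simp only [Set.mem_setOf_eq] at h2; omega)
    hP hx hy hQ ha hb
  exact ⟨v, hvX, hvF.1⟩

end TermFenceUp

namespace TermFenceUpT

variable {M k : ℕ} {d : Finset (Site 2)} {z : Site 2} {ω : SiteConfig (Site 2)} {S : Set (Site 2)}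
  (T : TermFenceUpT M d z k ω S)

/-- **A crossing of the catch tube `B'` meets the upper branch of a fence from above.** [cite: KestenPTM1982, §2.2] -/
theorem catchB'_meets (hk : 2 ≤ k) (hz : z ∈ trapO M) {X : Set (Site 2)} {x y : Site 2}
    (hX : X ⊆ (catchTubeB' M (z 1) k).box) (hP : PathIn triGraph X x y) (hx : x 0 = 2 * (M : ℤ) + k)
    (hy : y 0 = 2 * (M : ℤ) + 3 * k) :
    ∃ Bs : Set (Site 2), Bs ⊆ triStrip (z 0 + k) (z 1 - 2 * k) k (2 * k - 1) ∩ ω ∧ T.m ∈ Bs ∧ (∀ w ∈ Bs, PathIn triGraph Bs T.m w) ∧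
      ∃ v, v ∈ X ∧ v ∈ Bs := by
  have hz' := trapO_coord hz
  obtain ⟨Bs, hBs, hmB, hstar, a, b, ha, hb, hQ⟩ := T.exists_midhigh_chain hk
  have hk1 : ((k - 1 : ℕ) : ℤ) = (k : ℤ) - 1 := by omega
  have hk21 : ((2 * k - 1 : ℕ) : ℤ) = 2 * (k : ℤ) - 1 := by omega
  obtain ⟨x', y', hx', hy', hP'⟩ := hP.exists_slab_crossing 0 (L := 2 * (M : ℤ) + k) (R := 2 * (M : ℤ) + 2 * k)
    (by omega) (by rw [hx]) (by rw [hy]; omega)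
  obtain ⟨v, hvB, hvX⟩ := PathIn.tri_crossings_meet' (L := 2 * (M : ℤ) + k) (R := 2 * (M : ℤ) + 2 * k)
    (B := z 1 - ((k - 1 : ℕ) : ℤ)) (T := z 1 - 1)
    (A := Bs ∩ {v | z 1 - ((k - 1 : ℕ) : ℤ) ≤ v 1 ∧ v 1 ≤ z 1 - 1})
    (A' := X ∩ {v | 2 * (M : ℤ) + k ≤ v 0 ∧ v 0 ≤ 2 * (M : ℤ) + 2 * k})
    (fun w hw => by
      have h := (hBs hw.1).1; rw [mem_triStrip, hk21] at h
      have h2 := hw.2; simp only [Set.mem_setOf_eq] at h2; omega)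
    (fun w hw => by
      have h := hX hw.1; rw [Tube.mem_box] at h; simp only [catchTubeB'] at h
      have h2 := hw.2; simp only [Set.mem_setOf_eq] at h2; omega)
    hQ ha hb hP' hx' hy'
  exact ⟨Bs, hBs, hmB, hstar, v, hvX.1, hvB.1⟩

end TermFenceUpT

end Literature.Probability.Percolation
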